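import Mathlib
import Summits.Ventures.PercRepro2.Defs
import Summits.Ventures.PercRepro2.Independence
import Summits.Ventures.PercRepro2.Harris
import Summits.Ventures.PercRepro2.Graph
import Summits.Ventures.PercRepro2.Exploration
import Summits.Ventures.PercRepro2.Events
import Summits.Ventures.PercRepro2.FourFunctions
import Summits.Ventures.PercRepro2.Induced
import Summits.Ventures.PercRepro2.Frontier
import Summits.Ventures.PercRepro2.ObsIndependence
import Summits.Ventures.PercRepro2.BHK
import Summits.Ventures.PercRepro2.BHKEvents
import Summits.Ventures.PercRepro2.VdBKahn
import Summits.Ventures.PercRepro2.BHKAvoid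
import Summits.Ventures.PercRepro2.OrderPreservation
import Summits.Ventures.PercRepro2.OrderPreservationDual
import Summits.Ventures.PercRepro2.OrderPreservationQuant
import Summits.Ventures.PercRepro2.Merge
import Summits.Ventures.PercRepro2.OrderPreservationUnion
import Summits.Ventures.PercRepro2.R2PrimeThreeReduction
import Summits.Ventures.PercRepro2.YBridge
import Summits.Ventures.PercRepro2.EdgeBHK
import Summits.Ventures.PercRepro2.N0
import Summits.Ventures.PercRepro2.Rungs
import Summits.Ventures.PercRepro2.HF2
import Summits.Ventures.PercRepro2.ZIdentities
import Summits.Ventures.PercRepro2.ZReduction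
import Summits.Ventures.PercRepro2.ZReductionSum
import Summits.Ventures.PercRepro2.Yu1Functionals
import Summits.Ventures.PercRepro2.Yu1Events
import Summits.Ventures.PercRepro2.Yu1
import Summits.Ventures.PercRepro2.LBSplit
import Summits.Ventures.PercRepro2.YDelta
import Summits.Ventures.PercRepro2.SD
import Summits.Ventures.PercRepro2.SDHeavy
import Summits.Ventures.PercRepro2.Lambda
import Summits.Ventures.PercRepro2.LambdaTau
import Summits.Ventures.PercRepro2.LambdaSlack
import Summits.Ventures.PercRepro2.ZDelta

/-!
# The bridge `YDelta` → `ZReduction`: R2′(3) from `Yu1Delta ∧ Yu2Delta`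
(blind cell PercRepro2, typer-1)

p1's `ZReduction.r2prime3_of_Z` takes the rows 2′Y1Δ / 2′Y2Δ with `Δ_l`, `Δ_h` spelled through
`(connEvent a₁ a₂)ᶜ ∩ … ∩ connEvent a₂ a₃ ∩ …`; `YDelta.Yu1Delta` / `Yu2Delta` spell them through
`TEvent`.  The two spellings are the same events (p1's `deltaL_eq`, `deltaH_eq` in `ZReductionSum`), so

* `r2prime3_of_Yu1Delta_Yu2Delta`: `Yu1Delta ∧ Yu2Delta` (+ N0, the orders, distinctness,
  `P(PD) > 0`) `⟹ P(o ↔ A, o ↔ b) ≥ P(o ↔ A, a₃ ↔ b)`, `A = {a₃, a₁, a₂}`;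
* `r2prime3_of_SD`: the same from the up-set statements `SDLightUp ∧ SDHeavyUp` (both dead after
  NEG-32, kept as the formal corollary);
* **`scprime_of_ZDelta` / `r2prime3_of_ZDelta`** — the chain of record after NEG-32: p1's
  one-hypothesis `ZReductionSum.scprime_of_Zsum` / `r2prime3_of_Zsum` with the hypothesis `ZDelta`
  (row 2′ZΔ), i.e. `R2′(3) ⇐ SC′ ⇐ (ZΔ)`; `r2prime3_of_ZDelta_all`: the closure `ZDelta_all`
  gives R2′(3) on every instance with `P(PD) > 0` and `a₃ = argmin`.
-/

namespace Summit.Ventures.PercRepro2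

open UnionCluster

section ZBridge

variable {V : Type*} {E : Type*} [Fintype E] [DecidableEq E] [Fintype V] [DecidableEq V]
  {R : Type*} [Field R] [LinearOrder R] [IsStrictOrderedRing R]

/-- **R2′(3) from `Yu1Delta ∧ Yu2Delta`** (the reduction of record, in the `YDelta` vocabulary):
with (N0), the orders `P(a₃ ↔ b) ≤ P(a₁ ↔ b) ≤ P(a₂ ↔ b)`, distinctness and `P(PD) > 0`,
`P(o ↔ A, o ↔ b) ≥ P(o ↔ A, a₃ ↔ b)` for `A = {a₃, a₁, a₂}`. -/
theorem r2prime3_of_Yu1Delta_Yu2Delta (p : E → R) (hp : IsProbVec p) (ends : E → Sym2 V)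
    {o a₁ a₂ a₃ b : V} (h12 : a₁ ≠ a₂) (h31 : a₃ ≠ a₁) (h32 : a₃ ≠ a₂) (ho : o ≠ a₁) (ho2 : o ≠ a₂)
    (hb2 : b ≠ a₂) (hPD : 0 < prob p (PDEvent ends a₁ a₂ a₃))
    (hY1 : Yu1Delta p ends o a₁ a₂ a₃ b) (hY2 : Yu2Delta p ends o a₁ a₂ a₃ b)
    (hord : prob p (connEvent ends a₁ b) ≤ prob p (connEvent ends a₂ b))
    (h3 : prob p (connEvent ends a₃ b) ≤ prob p (connEvent ends a₁ b)) :
    prob p (hitEvent ends o {a₃, a₁, a₂} ∩ connEvent ends o b) ≥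
      prob p (hitEvent ends o {a₃, a₁, a₂} ∩ connEvent ends a₃ b) := by
  unfold Yu1Delta at hY1
  unfold Yu2Delta at hY2
  rw [deltaL_eq] at hY1
  rw [deltaH_eq] at hY2
  exact r2prime3_of_Z p hp ends h12 h31 h32 ho ho2 hb2 hPD (by linarith) (by linarith) hord h3

/-- **R2′(3) from the up-set statements of record** `SDLightUp ∧ SDHeavyUp`. -/
theorem r2prime3_of_SD (p : E → R) (hp : IsProbVec p) (ends : E → Sym2 V)
    {o a₁ a₂ a₃ b : V} (h12 : a₁ ≠ a₂) (h31 : a₃ ≠ a₁) (h32 : a₃ ≠ a₂) (ho : o ≠ a₁) (ho2 : o ≠ a₂)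
    (hb2 : b ≠ a₂) (hPD : 0 < prob p (PDEvent ends a₁ a₂ a₃))
    (hL : SDLightUp p ends a₁ a₂ a₃ b) (hH : SDHeavyUp p ends a₁ a₂ a₃ b)
    (hord : prob p (connEvent ends a₁ b) ≤ prob p (connEvent ends a₂ b))
    (h3 : prob p (connEvent ends a₃ b) ≤ prob p (connEvent ends a₁ b)) :
    prob p (hitEvent ends o {a₃, a₁, a₂} ∩ connEvent ends o b) ≥
      prob p (hitEvent ends o {a₃, a₁, a₂} ∩ connEvent ends a₃ b) :=
  r2prime3_of_Yu1Delta_Yu2Delta p hp ends h12 h31 h32 ho ho2 hb2 hPD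
    (Yu1Delta_of_SDLightUp p ends o a₁ a₂ a₃ b hL) (Yu2Delta_of_SDHeavyUp p ends o a₁ a₂ a₃ b hH)
    hord h3

/-- **SC′ from (ZΔ)** (the chain of record after NEG-32; p1's `scprime_of_Zsum` with the hypothesis
`ZDelta`). -/
theorem scprime_of_ZDelta (p : E → R) (hp : IsProbVec p) (ends : E → Sym2 V) {o a₁ a₂ a₃ b : V}
    (h12 : a₁ ≠ a₂) (h31 : a₃ ≠ a₁) (ho : o ≠ a₁) (hPD : 0 < prob p (PDEvent ends a₁ a₂ a₃))
    (hZ : ZDelta p ends o a₁ a₂ a₃ b)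
    (hord : prob p (connEvent ends a₁ b) ≤ prob p (connEvent ends a₂ b))
    (h3 : prob p (connEvent ends a₃ b) ≤ prob p (connEvent ends a₁ b)) :
    SCPrimeIneq p ends o a₃ a₁ a₂ b := by
  unfold ZDelta at hZ
  exact scprime_of_Zsum p hp ends h12 h31 ho hPD hZ hord h3

/-- **R2′(3) from (ZΔ)**: `P(o ↔ A, o ↔ b) ≥ P(o ↔ A, a₃ ↔ b)`, `A = {a₃, a₁, a₂}` (p1's
`r2prime3_of_Zsum` with the hypothesis `ZDelta`). -/
theorem r2prime3_of_ZDelta (p : E → R) (hp : IsProbVec p) (ends : E → Sym2 V) {o a₁ a₂ a₃ b : V}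
    (h12 : a₁ ≠ a₂) (h31 : a₃ ≠ a₁) (h32 : a₃ ≠ a₂) (ho : o ≠ a₁) (ho2 : o ≠ a₂) (hb2 : b ≠ a₂)
    (hPD : 0 < prob p (PDEvent ends a₁ a₂ a₃)) (hZ : ZDelta p ends o a₁ a₂ a₃ b)
    (hord : prob p (connEvent ends a₁ b) ≤ prob p (connEvent ends a₂ b))
    (h3 : prob p (connEvent ends a₃ b) ≤ prob p (connEvent ends a₁ b)) :
    prob p (hitEvent ends o {a₃, a₁, a₂} ∩ connEvent ends o b) ≥
      prob p (hitEvent ends o {a₃, a₁, a₂} ∩ connEvent ends a₃ b) := by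
  unfold ZDelta at hZ
  exact r2prime3_of_Zsum p hp ends h12 h31 h32 ho ho2 hb2 hPD hZ hord h3

end ZBridge

section ZBridgeClosure

variable {R : Type*} [Field R] [LinearOrder R] [IsStrictOrderedRing R]

/-- **R2′(3) from the closure `ZDelta_all`**: on every finite graph and every marking with
`P(PD) > 0`, the labelling `P(a₁ ↔ b) ≤ P(a₂ ↔ b)` and `a₃` the `b`-minimiser,
`P(o ↔ A, o ↔ b) ≥ P(o ↔ A, a₃ ↔ b)`, `A = {a₃, a₁, a₂}`. -/
theorem r2prime3_of_ZDelta_all (hZ : ZDelta_all R) {V E : Type} [Fintype V] [DecidableEq V]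
    [Fintype E] [DecidableEq E] (ends : E → Sym2 V) (p : E → R) (hp : IsProbVec p)
    {o a₁ a₂ a₃ b : V} (h12 : a₁ ≠ a₂) (h13 : a₁ ≠ a₃) (h23 : a₂ ≠ a₃) (ho1 : o ≠ a₁) (ho2 : o ≠ a₂)
    (ho3 : o ≠ a₃) (hob : o ≠ b) (hb1 : b ≠ a₁) (hb2 : b ≠ a₂) (hb3 : b ≠ a₃)
    (hPD : 0 < prob p (PDEvent ends a₁ a₂ a₃))
    (hord : prob p (connEvent ends a₁ b) ≤ prob p (connEvent ends a₂ b))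
    (h3 : prob p (connEvent ends a₃ b) ≤ prob p (connEvent ends a₁ b)) :
    prob p (hitEvent ends o {a₃, a₁, a₂} ∩ connEvent ends o b) ≥
      prob p (hitEvent ends o {a₃, a₁, a₂} ∩ connEvent ends a₃ b) :=
  r2prime3_of_ZDelta p hp ends h12 (Ne.symm h13) (Ne.symm h23) ho1 ho2 hb2 hPD
    (hZ V E ends p hp o a₁ a₂ a₃ b h12 h13 h23 ho1 ho2 ho3 hob hb1 hb2 hb3 hord) hord h3

end ZBridgeClosure

end Summit.Ventures.PercRepro2
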